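import Literature.Computability.Cryptography.ZhandryPRFMod
import Literature.NumberTheory.LFunctions.RHWave0PNTProofs
import HarnessLib

/-!
# Zhandry's moduli `A = primes ∩ [√N/4, √N/2]`: size and divisibility

Topic `Literature/Computability/Cryptography`. The two arithmetic facts about the moduli set
`zhandryModuli N` (`ZhandryPRFMod.lean`; S. Aaronson, L. Chen, CCC 2017, arXiv:1612.05903, §7.2
and App. 13, p. 42) used in the proof of Lemma 7.5 (1) ("`PRF^mod` is a classically secure
PRF"), both PROVED:

* `card_filter_modEq_zhandryModuli_le_two` — "each difference can be divisible by at most two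
  different moduli from `A` (recall that each number in `A` lies in `[√N/4, √N/2]`)": for
  `N = 2^m ≥ 2^14` and `x ≠ y` below `N`, at most two moduli `a ∈ A` have `x ≡ y (mod a)` (three
  distinct primes `≥ √N/4` dividing `|x − y| < N` would have product `≥ (√N/4)³ > N`);
* `exists_sqrt_le_mul_card_zhandryModuli` — "`|A| ≥ Ω(√N / log N)`": there is `m₀` with
  `⌊√(2^m)⌋ ≤ 16 · m · |A_{2^m}|` for all `m ≥ m₀`. The paper appeals to the prime number theorem;
  so do we: the tree's `Literature.NumberTheory.LFunctions.chebyshevTheta_isEquivalent` (`θ(x) ~ x`,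
  proved there from the Wiener–Ikehara theorem) gives `θ(s/2) − θ(s/4) ≥ 3s/16` for large
  `s = ⌊√N⌋`, and every prime counted is at most `s/2`, so the number of primes in `(s/4, s/2]` is at
  least `(3s/16)/log s ≥ 3s/(8m)`. (Chebyshev's elementary bounds `x log 2 − o(x) ≤ θ(x) ≤ x log 4`
  of `Mathlib.NumberTheory.Chebyshev` do not suffice for an interval of ratio `2`.)

## References

* [AaronsonChen2017] S. Aaronson, L. Chen, CCC 2017 (arXiv:1612.05903), §7.2 (p. 29) and App. 13
  (p. 42).
* Mathlib `Mathlib.NumberTheory.Chebyshev` (`Chebyshev.theta`, `theta_eq_sum_primesLE`); the tree's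
  `Literature/NumberTheory/LFunctions/RHWave0PNTProofs.lean` (the prime number theorem).
-/

namespace Literature.Computability.Cryptography

open Filter Asymptotics Finset Real
open scoped Chebyshev

/-! ### At most two moduli divide one difference -/

/-- Congruence modulo `a` of two naturals means `a` divides their distance. [folklore] -/
private theorem dvd_natAbs_sub_of_mod_eq {x y a : ℕ} (h : x % a = y % a) :
    a ∣ Int.natAbs ((y : ℤ) - x) := by
  have hmod : x ≡ y [MOD a] := h
  rw [← Int.ofNat_dvd_left]
  exact (Nat.modEq_iff_dvd.1 hmod)

/-- **"Each difference can be divisible by at most two different moduli from `A`"**: for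
`N = 2^m` with `m ≥ 14` and distinct `x, y < N`, at most two of Zhandry's moduli `a` (primes in
`[⌊√N⌋/4, ⌊√N⌋/2]`) satisfy `x ≡ y (mod a)` — three distinct such primes would all divide
`0 < |x − y| < N`, hence so would their product `≥ (⌊√N⌋/4)³ > N`.
[cite: AaronsonChen2017, App. 13 (p. 42)] -/
theorem card_filter_modEq_zhandryModuli_le_two {m : ℕ} (hm : 14 ≤ m) {x y : ℕ} (hx : x < 2 ^ m)
    (hy : y < 2 ^ m) (hxy : x ≠ y) :
    ((zhandryModuli (2 ^ m)).filter fun a => x % a = y % a).card ≤ 2 := by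
  classical
  by_contra hlt
  rw [not_le, Finset.two_lt_card] at hlt
  obtain ⟨a, ha, b, hb, c, hc, hab, hac, hbc⟩ := hlt
  rw [Finset.mem_filter] at ha hb hc
  -- the distance `d = |x - y|`, `0 < d < 2^m`
  set d : ℕ := Int.natAbs ((y : ℤ) - x) with hd
  have hdpos : 0 < d := by
    rw [hd, Int.natAbs_pos]
    intro h0
    exact hxy (by exact_mod_cast (sub_eq_zero.1 h0).symm)
  have hdlt : d < 2 ^ m := by
    rw [hd]
    omega
  -- the three moduli are distinct primes dividing `d`
  have hpa := prime_of_mem_zhandryModuli ha.1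
  have hpb := prime_of_mem_zhandryModuli hb.1
  have hpc := prime_of_mem_zhandryModuli hc.1
  have hda : a ∣ d := dvd_natAbs_sub_of_mod_eq ha.2
  have hdb : b ∣ d := dvd_natAbs_sub_of_mod_eq hb.2
  have hdc : c ∣ d := dvd_natAbs_sub_of_mod_eq hc.2
  have habc : a * b * c ∣ d :=
    Nat.Coprime.mul_dvd_of_dvd_of_dvd
      (Nat.Coprime.mul_left ((Nat.coprime_primes hpa hpc).2 hac) ((Nat.coprime_primes hpb hpc).2 hbc))
      (Nat.Coprime.mul_dvd_of_dvd_of_dvd ((Nat.coprime_primes hpa hpb).2 hab) hda hdb) hdc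
  have hle : a * b * c ≤ d := Nat.le_of_dvd hdpos habc
  -- sizes: `s = ⌊√N⌋ ≥ 128`, each modulus `≥ s/4`
  set s := Nat.sqrt (2 ^ m) with hs
  have hs128 : 128 ≤ s := by
    rw [hs, Nat.le_sqrt]
    calc 128 * 128 = 2 ^ 14 := by norm_num
      _ ≤ 2 ^ m := Nat.pow_le_pow_right (by norm_num) hm
  have hN : 2 ^ m < (s + 1) * (s + 1) := Nat.lt_succ_sqrt (2 ^ m)
  set j := s / 4 with hj
  have hj32 : 32 ≤ j := by omega
  have hsj : s + 1 ≤ 4 * j + 4 := by omega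
  have haj : j ≤ a := (mem_zhandryModuli.1 ha.1).1
  have hbj : j ≤ b := (mem_zhandryModuli.1 hb.1).1
  have hcj : j ≤ c := (mem_zhandryModuli.1 hc.1).1
  have hprod : j * j * j ≤ a * b * c :=
    Nat.mul_le_mul (Nat.mul_le_mul haj hbj) hcj
  -- `j³ ≤ abc ≤ d < 2^m < (s+1)² ≤ (4j+4)²`, impossible for `j ≥ 32`
  have h1 : j * j * j < (4 * j + 4) * (4 * j + 4) := by
    calc j * j * j ≤ a * b * c := hprod
      _ < (s + 1) * (s + 1) := by omega
      _ ≤ (4 * j + 4) * (4 * j + 4) := Nat.mul_le_mul hsj hsj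
  nlinarith

/-! ### The moduli set has `Ω(√N / log N)` elements -/

/-- The prime number theorem in the form used: eventually `|θ(x) − x| ≤ x/12`. [folklore] -/
private theorem eventually_abs_theta_sub_le :
    ∃ X₀ : ℝ, ∀ x, X₀ ≤ x → |θ x - x| ≤ x / 12 := by
  have h := (Literature.NumberTheory.LFunctions.chebyshevTheta_isEquivalent.isLittleO.def
    (by norm_num : (0 : ℝ) < 1 / 12))
  obtain ⟨X₀, hX₀⟩ := Filter.eventually_atTop.1 h
  refine ⟨max X₀ 0, fun x hx => ?_⟩
  have hx0 : 0 ≤ x := le_trans (le_max_right _ _) hx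
  have h1 := hX₀ x (le_trans (le_max_left _ _) hx)
  simp only [Pi.sub_apply, Real.norm_eq_abs, abs_of_nonneg hx0] at h1
  linarith

/-- The primes in `(s/4, s/2]` are Zhandry moduli for `N` with `⌊√N⌋ = s`, and their logarithms
sum to `θ(s/2) − θ(s/4)`. [cite: AaronsonChen2017, §7.2 (p. 29)] -/
private theorem theta_half_sub_theta_quarter_le (N : ℕ) :
    θ ((Nat.sqrt N : ℝ) / 2) - θ ((Nat.sqrt N : ℝ) / 4) ≤
      (zhandryModuli N).card * Real.log (Nat.sqrt N) := by
  classical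
  set s := Nat.sqrt N with hs
  have hfl2 : ⌊(s : ℝ) / 2⌋₊ = s / 2 := Nat.floor_div_eq_div s 2
  have hfl4 : ⌊(s : ℝ) / 4⌋₊ = s / 4 := Nat.floor_div_eq_div s 4
  have hsub : Nat.primesLE (s / 4) ⊆ Nat.primesLE (s / 2) := by
    intro p hp
    rw [Nat.mem_primesLE] at hp ⊢
    exact ⟨hp.1.trans (Nat.div_le_div_left (by norm_num) (by norm_num)), hp.2⟩
  have hθ : θ ((s : ℝ) / 2) - θ ((s : ℝ) / 4) =
      ∑ p ∈ Nat.primesLE (s / 2) \ Nat.primesLE (s / 4), Real.log p := by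
    rw [Chebyshev.theta_eq_sum_primesLE, Chebyshev.theta_eq_sum_primesLE, hfl2, hfl4,
      ← Finset.sum_sdiff hsub, add_sub_cancel_right]
  rw [hθ]
  have hmem : ∀ p ∈ Nat.primesLE (s / 2) \ Nat.primesLE (s / 4), p ∈ zhandryModuli N ∧ p ≤ s := by
    intro p hp
    rw [Finset.mem_sdiff, Nat.mem_primesLE, Nat.mem_primesLE] at hp
    obtain ⟨⟨hp2, hpp⟩, hp4⟩ := hp
    have hp4' : s / 4 ≤ p := by
      by_contra h
      exact hp4 ⟨by omega, hpp⟩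
    exact ⟨mem_zhandryModuli.2 ⟨hp4', hp2, hpp⟩, hp2.trans (Nat.div_le_self _ _)⟩
  calc ∑ p ∈ Nat.primesLE (s / 2) \ Nat.primesLE (s / 4), Real.log p
      ≤ ∑ p ∈ Nat.primesLE (s / 2) \ Nat.primesLE (s / 4), Real.log s := by
        refine Finset.sum_le_sum fun p hp => ?_
        have hpp := (Nat.mem_primesLE.1 (Finset.mem_sdiff.1 hp).1).2
        exact Real.log_le_log (by exact_mod_cast hpp.pos) (by exact_mod_cast (hmem p hp).2)
    _ = (Nat.primesLE (s / 2) \ Nat.primesLE (s / 4)).card * Real.log s := by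
        rw [Finset.sum_const, nsmul_eq_mul]
    _ ≤ (zhandryModuli N).card * Real.log s := by
        have hs1 : 0 ≤ Real.log s := by
          rcases Nat.eq_zero_or_pos s with h0 | hpos
          · simp [h0]
          · exact Real.log_nonneg (by exact_mod_cast hpos)
        refine mul_le_mul_of_nonneg_right ?_ hs1
        exact_mod_cast Finset.card_le_card fun p hp => (hmem p hp).1

/-- **`|A| ≥ Ω(√N / log N)`** ("since `|A| ≥ Ω(√N/log N)`", by the prime number theorem), in the
explicit form: there is `m₀` such that `⌊√(2^m)⌋ ≤ 16 · m · |zhandryModuli (2^m)|` for all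
`m ≥ m₀`. [cite: AaronsonChen2017, App. 13 (p. 42)] -/
theorem exists_sqrt_le_mul_card_zhandryModuli :
    ∃ m₀ : ℕ, ∀ m, m₀ ≤ m → (Nat.sqrt (2 ^ m) : ℝ) ≤ 16 * m * (zhandryModuli (2 ^ m)).card := by
  obtain ⟨X₀, hX₀⟩ := eventually_abs_theta_sub_le
  -- a threshold `T ≥ X₀`, `T ≥ 8`, and `m₀` with `(4T)² ≤ 2^m₀`
  set T : ℕ := ⌈max X₀ 8⌉₊ with hT
  have hTX : X₀ ≤ T := le_trans (le_max_left _ _) (Nat.le_ceil _)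
  have hT8 : (8 : ℝ) ≤ T := le_trans (le_max_right X₀ 8) (Nat.le_ceil _)
  refine ⟨(4 * T) * (4 * T), fun m hm => ?_⟩
  set s := Nat.sqrt (2 ^ m) with hs
  -- `s ≥ 4T`
  have hs4T : 4 * T ≤ s := by
    rw [hs, Nat.le_sqrt]
    exact le_trans (le_trans hm (Nat.lt_two_pow_self).le) le_rfl
  have hsR : (4 : ℝ) * T ≤ s := by exact_mod_cast hs4T
  have hs0 : (0 : ℝ) < s := by linarith
  have hs1 : (1 : ℝ) ≤ s := by linarith
  -- PNT at `s/2` and `s/4`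
  have h2 := hX₀ ((s : ℝ) / 2) (by linarith)
  have h4 := hX₀ ((s : ℝ) / 4) (by linarith)
  have hθ : 3 * (s : ℝ) / 16 ≤ θ ((s : ℝ) / 2) - θ ((s : ℝ) / 4) := by
    rw [abs_le] at h2 h4
    linarith [h2.1, h4.2]
  -- `θ(s/2) − θ(s/4) ≤ |A| log s` and `log s ≤ m/2`
  have hsum := theta_half_sub_theta_quarter_le (2 ^ m)
  rw [← hs] at hsum
  have hlogs : Real.log s ≤ m / 2 := by
    have hss : (s : ℝ) * s ≤ 2 ^ m := by
      rw [hs]; exact_mod_cast Nat.sqrt_le (2 ^ m)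
    have h1 : Real.log ((s : ℝ) * s) ≤ Real.log ((2 : ℝ) ^ m) :=
      Real.log_le_log (by positivity) hss
    rw [Real.log_mul hs0.ne' hs0.ne', Real.log_pow] at h1
    have hl2 := Real.log_two_lt_d9
    have hm0 : (0 : ℝ) ≤ m := Nat.cast_nonneg m
    nlinarith
  have hA0 : (0 : ℝ) ≤ (zhandryModuli (2 ^ m)).card := Nat.cast_nonneg _
  have key : 3 * (s : ℝ) / 16 ≤ (zhandryModuli (2 ^ m)).card * (m / 2) :=
    hθ.trans (hsum.trans (mul_le_mul_of_nonneg_left hlogs hA0))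
  nlinarith

/-- The size bound in reciprocal form: eventually `1/|A_{2^m}| ≤ 16 m / ⌊√(2^m)⌋` and `A ≠ ∅`.
[cite: AaronsonChen2017, App. 13 (p. 42)] -/
theorem exists_inv_card_zhandryModuli_le :
    ∃ m₀ : ℕ, ∀ m, m₀ ≤ m → (zhandryModuli (2 ^ m)).Nonempty ∧
      ((zhandryModuli (2 ^ m)).card : ℝ)⁻¹ ≤ 16 * m / Nat.sqrt (2 ^ m) := by
  obtain ⟨m₀, hm₀⟩ := exists_sqrt_le_mul_card_zhandryModuli
  refine ⟨max m₀ 4, fun m hm => ?_⟩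
  have hm4 : 4 ≤ m := le_trans (le_max_right _ _) hm
  have hne : (zhandryModuli (2 ^ m)).Nonempty := zhandryModuli_two_pow_nonempty hm4
  refine ⟨hne, ?_⟩
  have h := hm₀ m (le_trans (le_max_left _ _) hm)
  have hA : (0 : ℝ) < (zhandryModuli (2 ^ m)).card := by exact_mod_cast hne.card_pos
  have hs : (0 : ℝ) < Nat.sqrt (2 ^ m) := by
    have : 0 < Nat.sqrt (2 ^ m) := Nat.sqrt_pos.2 (Nat.two_pow_pos m)
    exact_mod_cast this
  rw [inv_le_iff_one_le_mul₀ hA, div_mul_eq_mul_div, one_le_div hs]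
  linarith

end Literature.Computability.Cryptography
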